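import Literature.NumberTheory.Automorphic.Liu2021.AppendixC.SeesawSource
import HarnessLib

/-!
# [Liu 2021, Thm. 4.15 proof] the seesaw input `S34SomeSource` is invariant under transport of the §4.2 datum

Topic `NumberTheory/Automorphic/Liu2021/AppendixC`; namespace `Literature.NumberTheory.Automorphic.Liu2021.AppendixC`.  PROOF FILE
(theorems only — no definition, no named fact, no instance, no `sorry`), continuation of `SeesawSource.lean` (the carriers
`SeesawSource` ∕ `S34SomeSource` of the (S)-split of [Liu2021] Thm. 4.15's proof, print p. 51 l. 2199–2213).

WHY.  A consumer may hold the §4.2 datum in two propositionally equal spellings `C = C'` — in the cell `hodgecm-mathlib` the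
registry `a3_liu418` quantifies `stub_S34` over the TOTAL carrier `Model.sec42DataOf … = CV` (a `dite` on `4 ≤ [F:ℚ]`), while every
record-currency construction (pieces, Hecke translates, the bridge to the canonical model's complex fibre) is typed over the EXPLICIT
carrier `Model.sec42DataOfFourLe …` (`sec42DataOf_eq_of_four_le`), with the translates transported by `cast` along that equation
(`sec42DataOf_heckeTranslates`, mirror of `Sec42Data.TowerHom.castTarget`).  The two theorems below move `S34SomeSource` — pointwise
in `(U, X, T, Pin)`, and in the `∀ X induced by T` closure that the registry's `S34AtFace` instantiates — along `e : C = C'` with the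
dependent arguments related by `HEq`; the proofs are `subst` (the target carrier is a VARIABLE here, which is what makes `subst` legal
at the face).  Nothing of [Liu2021] is asserted: both statements are implications between instances of the tree's own predicate.
[Liu2021] Thm. 4.15 proof, FJcycle.tex l. 2185–2213; §4.2 l. 2053–2081 (the datum).
-/

set_option autoImplicit false

noncomputable section

open NumberField

namespace Literature.NumberTheory.Automorphic.Liu2021.AppendixC

variable {F E : Type} [Field F] [NumberField F] [IsTotallyReal F] [Field E] [NumberField E] [Algebra F E]
  [IsTotallyComplex E] [Algebra.IsQuadraticExtension F E]
variable {P5 : PropC5Data F E} {isotropicAt : ℕ → Prop}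

/-- **`S34SomeSource` along an equality of §4.2 data, pointwise.**  For `e : C = C'` and uniform families, étale Hecke data, Hecke
translates and pins related by `HEq` across `e`, the seesaw input for `(C, U, X, T, Pin)` implies the one for `(C', U', X', T', Pin')`
(`subst e`; then the `HEq`s are equalities). [cite: Liu2021, Thm. 4.15 proof p. 51 (FJcycle.tex l. 2199–2213); §4.2 l. 2053–2081] -/
theorem S34SomeSource.transport {C C' : Sec42Data P5 isotropicAt} (e : C = C')
    {U : UniformOmega C} {U' : UniformOmega C'} (hU : HEq U U') {ℓ : ℕ} [Fact ℓ.Prime]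
    {X : C.EtaleHeckeDatum ℓ} {X' : C'.EtaleHeckeDatum ℓ} (hX : HEq X X') (ι : ℂ ≃+* AlgebraicClosure ℚ_[ℓ])
    (μ : Literature.NumberTheory.Automorphic.IdeleClassGroup E →ₜ* Circle)
    (hμ : letI : IsCMField E := isCMField F E; IdeleClassGroup.IsConjugateSymplectic E μ)
    {T : C.HeckeTranslates} {T' : C'.HeckeTranslates} (hT : HEq T T')
    {Pin : ∀ {P5ₛ : PropC5Data F E} {isoₛ : ℕ → Prop} (Cₛ : Sec42Data P5ₛ isoₛ), (Cₛ.G →* C.G) → Prop}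
    {Pin' : ∀ {P5ₛ : PropC5Data F E} {isoₛ : ℕ → Prop} (Cₛ : Sec42Data P5ₛ isoₛ), (Cₛ.G →* C'.G) → Prop}
    (hPin : HEq @Pin @Pin') (h : S34SomeSource C U ℓ X ι μ hμ T Pin) : S34SomeSource C' U' ℓ X' ι μ hμ T' Pin' := by
  subst e
  cases hU
  cases hX
  cases hT
  cases hPin
  exact h

/-- **`S34SomeSource` along an equality of §4.2 data, in the `∀ X induced by T` closure** — the shape the registry's `S34AtFace`
instantiates at the face (`X.IsInducedBy T → S34SomeSource C U ℓ X ι μ hμ T Pin` for every étale Hecke datum `X`): a closer proves the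
closure at the explicit carrier and transports it ONCE to the total carrier (`C'` a variable ⇒ `subst`).
[cite: Liu2021, Thm. 4.15 proof p. 51 (FJcycle.tex l. 2199–2213); §4.2 l. 2053–2081; §4.3 l. 2160] -/
theorem S34SomeSource.forall_transport {C C' : Sec42Data P5 isotropicAt} (e : C = C')
    {U : UniformOmega C} {U' : UniformOmega C'} (hU : HEq U U') {ℓ : ℕ} [Fact ℓ.Prime]
    (ι : ℂ ≃+* AlgebraicClosure ℚ_[ℓ]) (μ : Literature.NumberTheory.Automorphic.IdeleClassGroup E →ₜ* Circle)
    (hμ : letI : IsCMField E := isCMField F E; IdeleClassGroup.IsConjugateSymplectic E μ)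
    {T : C.HeckeTranslates} {T' : C'.HeckeTranslates} (hT : HEq T T')
    {Pin : ∀ {P5ₛ : PropC5Data F E} {isoₛ : ℕ → Prop} (Cₛ : Sec42Data P5ₛ isoₛ), (Cₛ.G →* C.G) → Prop}
    {Pin' : ∀ {P5ₛ : PropC5Data F E} {isoₛ : ℕ → Prop} (Cₛ : Sec42Data P5ₛ isoₛ), (Cₛ.G →* C'.G) → Prop}
    (hPin : HEq @Pin @Pin')
    (h : ∀ X : C.EtaleHeckeDatum ℓ, X.IsInducedBy T → S34SomeSource C U ℓ X ι μ hμ T Pin) :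
    ∀ X' : C'.EtaleHeckeDatum ℓ, X'.IsInducedBy T' → S34SomeSource C' U' ℓ X' ι μ hμ T' Pin' := by
  subst e
  cases hU
  cases hT
  cases hPin
  exact h

/-- **A uniform family re-typed at an equal carrier, field by field.**  `UniformOmega C` sees the carrier only through `C.G = P5.G`
(`Sec42Data.G` is `P5.G` by `rfl`), so the fields of `U : UniformOmega C` ARE the fields of a `UniformOmega C'` for every `C'` over the same
`P5`; along `e : C = C'` that re-typed structure is `HEq` to `U` (`subst`, structure eta).  Its projections reduce (`(…).rho = U.rho` by `rfl`),
which is why a consumer at the other spelling of the carrier may keep naming `U.rho μ hμ ε χ` itself. [cite: Liu2021, Def. 4.11 (FJcycle.tex l. 2083–2097); §4.2 l. 2053–2081] -/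
theorem UniformOmega.heq_mk_of_eq {C C' : Sec42Data P5 isotropicAt} (e : C = C') (U : UniformOmega C) :
    HEq ({ Eps := U.Eps, epsOf := U.epsOf, Chi := U.Chi, omega := U.omega, rho := U.rho } : UniformOmega C') U := by
  subst e
  rfl

/-- The `cast` bookkeeping a consumer needs for `hU`/`hT`: a term transported by `cast` along `congrArg` of the datum equation is
`HEq` to itself (Mathlib `cast_heq`, packaged at the two dependent types that occur). [cite: Liu2021, §4.2 l. 2053–2081] -/
theorem heq_cast_uniformOmega {C C' : Sec42Data P5 isotropicAt} (e : C = C') (U' : UniformOmega C') :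
    HEq (cast (congrArg UniformOmega e.symm) U' : UniformOmega C) U' :=
  cast_heq _ _

/-- The same for Hecke translates (the shape of `Model.sec42DataOf_heckeTranslates_heq`). [cite: Liu2021, §4.2 l. 2070–2074] -/
theorem heq_cast_heckeTranslates {C C' : Sec42Data P5 isotropicAt} (e : C = C') (T' : C'.HeckeTranslates) :
    HEq (cast (congrArg (fun D => Sec42Data.HeckeTranslates D) e.symm) T' : C.HeckeTranslates) T' :=
  cast_heq _ _

end Literature.NumberTheory.Automorphic.Liu2021.AppendixC

end
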